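import Mathlib.RingTheory.MvPolynomial.Symmetric.NewtonIdentities
import Summits.ValiantsHypothesis.ValiantsHypothesis.Theorems.MonotoneRestorationOrbitRestorationQPTermBlocksPowerSumProducts
import HarnessLib

/-!
# Newton's identities inside the EVEN subalgebra: even elementary symmetric polynomials are polynomials in the even
# power sums and the products of two odd power sums

Route MonotoneRestoration, crux `OrbitRestorationQP` (stmt-ValiantsHypothesis-18293), line `depth-three-rung`; namespace
`Summit.ValiantsHypothesis.ValiantsHypothesis.Theorems.EvenNewton`.  Route-independent algebra.

Why (census `TERM-BLOCKS-g7g3.md` on the crux item).  By the support theorem for values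
(`ValueSymSupport.exists_symSupport`) no quasi-polynomial-orbit computation ever holds an ALTERNATING quantity such as an
odd power sum `p_{2i+1}(D) = Σ_j D_j^{2i+1}` of the column Vandermondes, or `e_{2m+1}(D)`; but the even power sums
`p_{2k}(D)` and the products `p_a(D) p_b(D)` (`a, b` odd) are restorable with one constant
(`TermBlocks.qpOrbitRestorable_psum_mul_psum_columnVandermondes`).  To restore `e_{2m}(D_1, …, D_n)` for GROWING `m` — a
matrix-symmetric VP family with `C(n,2m)` depth-three terms, an instance of the CRUX outside `A_∞` — one therefore needs
Newton's identities run INSIDE the even subalgebra.  This file proves the algebraic half: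

* `esymm_mem_evenSubalgebra` — for every `m`, `e_{2m} ∈ Algebra.adjoin K {p_{2k}} ∪ {p_{2a+1} p_{2b+1}}` in
  `MvPolynomial σ K` (`K` a field of characteristic `0`); together with
* `esymm_mul_psum_mem_evenSubalgebra` — `e_{2r+1} · p_{2i+1}` lies in the same subalgebra,
  by a joint strong induction on the degree using Mathlib's `MvPolynomial.mul_esymm_eq_sum`
  (`k e_k = (−1)^{k+1} Σ_{a<k} (−1)^a e_a p_{k−a}`): in degree `k` even the summands are `e_{even} p_{even}` or
  `(e_{odd} p_{odd})`, in degree `k` odd, after multiplying by `p_{2i+1}`, they are `e_{even} (p_{odd} p_{odd})` or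
  `(e_{odd} p_{odd}) p_{even}`; then divide by `k`.

The transport `X_j ↦ D_j` and the assembly of ONE value derivation (a polynomial expression in restorable invariant
generators is restorable with constant `+9`) are left to a sequel.  Nothing here bears on VP ≠ VNP.  Everything is
proved. [folklore]

## References
* I. G. Macdonald, *Symmetric Functions and Hall Polynomials*, 2nd ed. (1995), §I.2 (Newton's identities). [Macdonald1995]
-/

noncomputable section

open scoped Classical

-- `Summit.ValiantsHypothesis.ValiantsHypothesis.…` is the tree's single-conjunct layout (Sub = Summit).
set_option linter.dupNamespace false

namespace Summit.ValiantsHypothesis.ValiantsHypothesis.Theorems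

namespace EvenNewton

open MvPolynomial Finset

variable {σ : Type*} [Fintype σ] {K : Type*} [Field K] [CharZero K]

/-- **Joint parity induction.**  In `MvPolynomial σ K`, with `A` the subalgebra generated by the even power sums and
the products of two odd power sums: `e_k ∈ A` for `k` even and `e_k · p_{2i+1} ∈ A` for `k` odd. [folklore;
cite: Macdonald1995, §I.2] -/
theorem esymm_parity_mem (k : ℕ) :
    (Even k → esymm σ K k ∈ Algebra.adjoin K
      ((Set.range fun j : ℕ => psum σ K (2 * j)) ∪
        Set.range fun ab : ℕ × ℕ => psum σ K (2 * ab.1 + 1) * psum σ K (2 * ab.2 + 1))) ∧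
    (Odd k → ∀ i : ℕ, esymm σ K k * psum σ K (2 * i + 1) ∈ Algebra.adjoin K
      ((Set.range fun j : ℕ => psum σ K (2 * j)) ∪
        Set.range fun ab : ℕ × ℕ => psum σ K (2 * ab.1 + 1) * psum σ K (2 * ab.2 + 1))) := by
  set A : Subalgebra K (MvPolynomial σ K) := Algebra.adjoin K
      ((Set.range fun j : ℕ => psum σ K (2 * j)) ∪
        Set.range fun ab : ℕ × ℕ => psum σ K (2 * ab.1 + 1) * psum σ K (2 * ab.2 + 1)) with hA
  -- generators
  have hpe : ∀ j : ℕ, psum σ K (2 * j) ∈ A := fun j =>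
    Algebra.subset_adjoin (Set.mem_union_left _ ⟨j, rfl⟩)
  have hpe' : ∀ m : ℕ, Even m → psum σ K m ∈ A := by
    rintro m ⟨j, rfl⟩; rw [← two_mul]; exact hpe j
  have hpp : ∀ a b : ℕ, psum σ K (2 * a + 1) * psum σ K (2 * b + 1) ∈ A := fun a b =>
    Algebra.subset_adjoin (Set.mem_union_right _ ⟨(a, b), rfl⟩)
  have hpp' : ∀ m m' : ℕ, Odd m → Odd m' → psum σ K m * psum σ K m' ∈ A := by
    rintro m m' ⟨a, rfl⟩ ⟨b, rfl⟩; exact hpp a b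
  have hneg : ∀ a : ℕ, ((-1 : MvPolynomial σ K) ^ a) ∈ A := fun a => pow_mem (neg_mem (one_mem A)) a
  -- division by `k`
  have hdiv : ∀ (k : ℕ) (q : MvPolynomial σ K), 0 < k → (k : MvPolynomial σ K) * q ∈ A → q ∈ A := by
    intro k q hk hq
    have hk0 : ((k : K) : K) ≠ 0 := Nat.cast_ne_zero.2 hk.ne'
    have : q = ((k : K)⁻¹) • ((k : MvPolynomial σ K) * q) := by
      rw [smul_eq_C_mul, ← map_natCast (C : K →+* MvPolynomial σ K) k, ← mul_assoc, ← map_mul,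
        inv_mul_cancel₀ hk0, map_one, one_mul]
    rw [this]
    exact A.smul_mem hq _
  -- strong induction
  induction k using Nat.strong_induction_on with
  | _ k ih =>
  rcases Nat.eq_zero_or_pos k with rfl | hkpos
  · refine ⟨fun _ => ?_, fun h => absurd h (by decide)⟩
    rw [esymm_zero]; exact one_mem A
  have hnewton := mul_esymm_eq_sum σ K k
  -- parity transfer along the antidiagonal
  have hpar : ∀ a ∈ (antidiagonal k).filter (fun a => a.1 < k), a.1 < k ∧ a.1 + a.2 = k := fun a ha =>
    ⟨(mem_filter.1 ha).2, mem_antidiagonal.1 (mem_filter.1 ha).1⟩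
  constructor
  · -- `k` even: `e_k ∈ A`
    intro hkeven
    apply hdiv k _ hkpos
    rw [hnewton]
    refine mul_mem (hneg _) (Subalgebra.sum_mem A fun a ha => ?_)
    obtain ⟨halt, hak⟩ := hpar a ha
    rcases Nat.even_or_odd a.1 with h1 | h1
    · -- `e_{even} · p_{even}`
      have h2 : Even a.2 := by
        rcases Nat.even_or_odd a.2 with h2 | h2
        · exact h2
        · exfalso; exact Nat.not_even_iff_odd.2 (Even.add_odd h1 h2) (hak ▸ hkeven)
      exact mul_mem (mul_mem (hneg _) ((ih a.1 halt).1 h1)) (hpe' _ h2)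
    · -- `(e_{odd} · p_{odd})`
      have h2 : Odd a.2 := by
        rcases Nat.even_or_odd a.2 with h2 | h2
        · exfalso; exact Nat.not_even_iff_odd.2 (Odd.add_even h1 h2) (hak ▸ hkeven)
        · exact h2
      obtain ⟨i, hi⟩ := h2
      rw [mul_assoc, hi]
      exact mul_mem (hneg _) ((ih a.1 halt).2 h1 i)
  · -- `k` odd: `e_k · p_{2i+1} ∈ A`
    intro hkodd i
    apply hdiv k _ hkpos
    rw [← mul_assoc, hnewton, mul_assoc, Finset.sum_mul]
    refine mul_mem (hneg _) (Subalgebra.sum_mem A fun a ha => ?_)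
    obtain ⟨halt, hak⟩ := hpar a ha
    rcases Nat.even_or_odd a.1 with h1 | h1
    · -- `e_{even} · (p_{odd} p_{odd})`
      have h2 : Odd a.2 := by
        rcases Nat.even_or_odd a.2 with h2 | h2
        · exfalso; exact Nat.not_odd_iff_even.2 (Even.add h1 h2) (hak ▸ hkodd)
        · exact h2
      rw [mul_assoc]
      exact mul_mem (mul_mem (hneg _) ((ih a.1 halt).1 h1)) (hpp' _ _ h2 ⟨i, rfl⟩)
    · -- `(e_{odd} · p_{odd}) · p_{even}`
      have h2 : Even a.2 := by
        rcases Nat.even_or_odd a.2 with h2 | h2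
        · exact h2
        · exfalso; exact Nat.not_odd_iff_even.2 (Odd.add_odd h1 h2) (hak ▸ hkodd)
      have hre : (-1) ^ a.1 * esymm σ K a.1 * psum σ K a.2 * psum σ K (2 * i + 1) =
          (-1) ^ a.1 * (esymm σ K a.1 * psum σ K (2 * i + 1)) * psum σ K a.2 := by ring
      rw [hre]
      exact mul_mem (mul_mem (hneg _) ((ih a.1 halt).2 h1 i)) (hpe' _ h2)

/-- **Even elementary symmetric polynomials lie in the even subalgebra** generated by the even power sums and the
products of two odd power sums. [folklore; cite: Macdonald1995, §I.2] -/
theorem esymm_mem_evenSubalgebra (m : ℕ) :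
    esymm σ K (2 * m) ∈ Algebra.adjoin K
      ((Set.range fun j : ℕ => psum σ K (2 * j)) ∪
        Set.range fun ab : ℕ × ℕ => psum σ K (2 * ab.1 + 1) * psum σ K (2 * ab.2 + 1)) :=
  (esymm_parity_mem (σ := σ) (K := K) (2 * m)).1 (even_two_mul m)

/-- **`e_{2r+1} · p_{2i+1}` lies in the even subalgebra.** [folklore; cite: Macdonald1995, §I.2] -/
theorem esymm_mul_psum_mem_evenSubalgebra (r i : ℕ) :
    esymm σ K (2 * r + 1) * psum σ K (2 * i + 1) ∈ Algebra.adjoin K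
      ((Set.range fun j : ℕ => psum σ K (2 * j)) ∪
        Set.range fun ab : ℕ × ℕ => psum σ K (2 * ab.1 + 1) * psum σ K (2 * ab.2 + 1)) :=
  (esymm_parity_mem (σ := σ) (K := K) (2 * r + 1)).2 (odd_two_mul_add_one r) i

end EvenNewton

end Summit.ValiantsHypothesis.ValiantsHypothesis.Theorems

end
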